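import Mathlib
import HarnessLib

/-!
# Tauberian theorem for logarithmic summability: slow decrease (Móricz 2013, Cor. 3 = Kwee 1968, Lemma 3)

F. Móricz, *Necessary and sufficient Tauberian conditions for the logarithmic summability of
functions and sequences*, Studia Math. 219 (2013) 109–121, doi:10.4064/sm219-2-2 =
arXiv:1206.6188 [`Moricz2013`], §5 "Summability `(L,1)` of numerical sequences" (arXiv p. 4):

* (5.1) a real sequence `(s_k)_{k ≥ 1}` is *summable `(L,1)`* (logarithmically, "harmonic summable
  of order 1") to `A` if `(1/ℓ_n) ∑_{k=1}^n s_k / k → A`, where `ℓ_n := ∑_{k=1}^n 1/k ∼ log n`;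
* (5.6) `(s_k)` is *slowly decreasing with respect to summability `(L,1)`* if for every `ε > 0`
  there exist a natural number `n₀ = n₀(ε)` and a real `λ = λ(ε) > 1` such that
  `s_k − s_n ≥ −ε` whenever `n₀ ≤ n < k ≤ n^λ`;
* **Corollary 3.** "Suppose a sequence `(s_k)` of real numbers is slowly decreasing with respect to
  summability `(L,1)`.  If `(s_k)` is summable `(L,1)` to some `A ∈ ℝ`, then the ordinary limit (5.3)
  [`lim s_n = A`] also exists."  (Immediate from Thm 4 there; "earlier proved by Kwee [3, Lemma 3]
  in a different way" — B. Kwee, *A Tauberian theorem for the logarithmic method of summation*,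
  Proc. Cambridge Philos. Soc. 63 (1967) 401–405; the slow-decrease scale `k ≤ n^λ`, i.e.
  `log k / log n → 1`, Remark 2 there, is Schmidt's `(C,1)` scale `k ≤ λn` read in the variable
  `log n`.)

## Why it is here

Grounds the support item `Summit.Parity.BatemanHorn.Theses.HurwitzTauber.SchmidtScales`
(stmt-Parity-19030) and through it the theorem-grade crux `…HurwitzTauber.FrameToBH`
(stmt-Parity-19025): `SchmidtScales` asks, for `b ≥ 0` with `∑_{n ≤ x} b(n) ≤ Bx`, logarithmic
mean value `(∑_{n≤x} b(n)/n)/log x → C` and one-sided slow decrease of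
`F(N) = N⁻¹ ∑_{n ≤ N} b(n)` on the scales `N ≤ N' ≤ N^{1+δ}`, that `F(N) → C`.  With `s_N := F(N)`
the slow-decrease clause IS (5.6) (`λ = 1 + δ`), and the hypothesis is `(L,1)`-summability of
`(F(N))` to `C` after the Abel summation
`∑_{n≤x} b(n)/n = F(x) + ∑_{m<x} F(m)/(m+1) = ∑_{m≤x} F(m)/m + O(B)` and `ℓ_n ∼ log n`
(Mathlib `Real.tendsto_harmonic_sub_log`) — so the item is Corollary 3 ∘ (forty lines of
partial summation); it is not a one-line instantiation, hence vendored as a hypothesis.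

## Contents

* `IsLogSummable s A` — (5.1), with Mathlib's `harmonic n = ∑_{i<n} 1/(i+1) = ℓ_n` as normaliser.
* `IsSlowlyDecreasingLog s` — (5.6), verbatim.
* `Moricz2013_cor3_logSummable_slowlyDecreasing` — NAMED FACT (Corollary 3), a `def … : Prop`,
  no `sorry`; users take `(h : Moricz2013_cor3_logSummable_slowlyDecreasing)`.
* `IsSlowlyDecreasingLog.of_monotone`, `isLogSummable_const`,
  `Moricz2013_cor3_logSummable_slowlyDecreasing.const_instance` — sanity lemmas (non-decreasing
  sequences are slowly decreasing; constants are `(L,1)`-summable to themselves; the fact's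
  hypotheses are met non-vacuously).
-/

noncomputable section

open Filter Finset
open scoped Topology

namespace Literature.NumberTheory.LFunctions

/-- **Logarithmic summability `(L,1)`** of a real sequence to `A` (Móricz 2013, (5.1)):
`(1/ℓ_n) ∑_{k=1}^n s_k/k → A` with `ℓ_n = ∑_{k=1}^n 1/k` (= Mathlib's `harmonic n`; `ℓ_n ∼ log n`).
The value `s 0` never enters. [cite: Moricz2013, (5.1)] -/
def IsLogSummable (s : ℕ → ℝ) (A : ℝ) : Prop :=
  Tendsto (fun n : ℕ => (∑ k ∈ Icc 1 n, s k / (k : ℝ)) / (harmonic n : ℝ)) atTop (𝓝 A)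

/-- **Slow decrease with respect to summability `(L,1)`** (Móricz 2013, (5.6)): for every `ε > 0`
there are `n₀` and `λ > 1` with `s_k − s_n ≥ −ε` whenever `n₀ ≤ n < k ≤ n^λ` — Schmidt's
one-sided Tauberian condition on the scales `k ≤ n^λ` (equivalently `log k / log n → 1`,
Remark 2 there, Kwee's form). [cite: Moricz2013, (5.6)] -/
def IsSlowlyDecreasingLog (s : ℕ → ℝ) : Prop :=
  ∀ ε : ℝ, 0 < ε → ∃ (n₀ : ℕ) (lam : ℝ), 1 < lam ∧
    ∀ n k : ℕ, n₀ ≤ n → n < k → (k : ℝ) ≤ (n : ℝ) ^ lam → -ε ≤ s k - s n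

/-- NAMED FACT — **Móricz 2013, Corollary 3** (Studia Math. 219, §5, arXiv:1206.6188 p. 4; =
Kwee 1967/68, Lemma 3): "Suppose a sequence `(s_k)` of real numbers is slowly decreasing with
respect to summability `(L,1)`.  If `(s_k)` is summable `(L,1)` to some `A ∈ ℝ`, then the ordinary
limit `lim s_n = A` also exists."  Grounds
`Summit.Parity.BatemanHorn.Theses.HurwitzTauber.SchmidtScales` (stmt-Parity-19030: apply with
`s_N = N⁻¹∑_{n≤N} b(n)`; its logarithmic-mean hypothesis is `(L,1)`-summability of `(s_N)` after a
partial summation, see module docstring) and hence the Karamata–Schmidt chain of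
`…HurwitzTauber.FrameToBH` (stmt-Parity-19025). [cite: Moricz2013, Cor. 3] -/
def Moricz2013_cor3_logSummable_slowlyDecreasing : Prop :=
  ∀ (s : ℕ → ℝ) (A : ℝ), IsSlowlyDecreasingLog s → IsLogSummable s A → Tendsto s atTop (𝓝 A)

/-! ## Sanity lemmas (proved) -/

/-- A non-decreasing sequence is slowly decreasing w.r.t. `(L,1)` (take any `λ > 1`). [folklore] -/
theorem IsSlowlyDecreasingLog.of_monotone {s : ℕ → ℝ} (hs : Monotone s) : IsSlowlyDecreasingLog s := by
  intro ε hε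
  refine ⟨0, 2, by norm_num, fun n k _ hnk _ => ?_⟩
  have h := hs hnk.le
  linarith

/-- A constant sequence is `(L,1)`-summable to its value (for `n ≥ 1` the logarithmic mean of a
constant is the constant; `harmonic n ≠ 0`). [folklore] -/
theorem isLogSummable_const (A : ℝ) : IsLogSummable (fun _ => A) A := by
  unfold IsLogSummable
  refine tendsto_const_nhds.congr' ?_
  filter_upwards [eventually_ge_atTop 1] with n hn
  have hh : (harmonic n : ℝ) ≠ 0 := by
    have := harmonic_pos (Nat.one_le_iff_ne_zero.mp hn)
    exact_mod_cast this.ne'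
  have hsum : (∑ k ∈ Icc 1 n, A / (k : ℝ)) = A * (harmonic n : ℝ) := by
    rw [harmonic_eq_sum_Icc, Rat.cast_sum, mul_sum]
    refine sum_congr rfl fun k _ => ?_
    rw [Rat.cast_inv, Rat.cast_natCast, div_eq_mul_inv]
  rw [hsum, mul_div_assoc, div_self hh, mul_one]

/-- The hypotheses of the named fact are met non-vacuously (constant sequences), and its conclusion
holds there. [folklore] -/
theorem Moricz2013_cor3_logSummable_slowlyDecreasing.const_instance (A : ℝ) :
    IsSlowlyDecreasingLog (fun _ : ℕ => A) ∧ IsLogSummable (fun _ => A) A ∧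
      Tendsto (fun _ : ℕ => A) atTop (𝓝 A) :=
  ⟨IsSlowlyDecreasingLog.of_monotone monotone_const, isLogSummable_const A, tendsto_const_nhds⟩

end Literature.NumberTheory.LFunctions

end
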